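import Mathlib
import Summits.KontsevichZagierPeriods.Zeta5Search.RecordCellEzAtlas
import Summits.KontsevichZagierPeriods.Zeta5Search.RecordCellCzProof
import Summits.KontsevichZagierPeriods.Zeta5Search.GHatShift
import HarnessLib

/-!
# ζ(5) search — RECORD CELL E is a THEOREM: `v_p(W) ≥ −6`, `v_p(V) ≥ −9`, hence `v_p(Cas₇(b(n))) ≥ −15`, for `6n < p < 6.25n`

Cell `pub-zeta5` (HONEST FRAMING: systematic search; no irrationality claim unless certified), P1 prover seat generation 6.
On the record ray `b(n) = n·(41;17,…,11)`, for `n ≥ 2` and every prime `24n < 4p < 25n` (census g11 cell E = (6, 25/4), weight 0.250; the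
tree's THEOREM LB gives `−17`, the truth is `−14`): **`v_p(Cas₇(b(n))) ≥ −15`** (`recordCellEz`) through the digit-free facts
**`v_p(W(b′)) ≥ −6`, `v_p(V(b′)) ≥ −9` for `b′ = b(n)` and `b(n)+e₇`** (`zeroBlockE`, `zeroCellE_WV`).  Mechanism (gen-2 g9's "zero" cell /
`DoubleDropBonus`, a theorem here): the minimal classes (`m = −10`) are the centre-free six-point palindromes `EZ` of `RecordCellEzAtlas`, whose
conjugate pairs cancel in BOTH normalised digits `p⁷W_x`, `p¹⁰V_x` (`digits_of_level10` = `LevelClassDigits` at `E = −10`); every other class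
has `E ≥ −9`.  NEW w.r.t. the cells A, C, D: the pair of minimal classes through the moved points `11n`, `30n` is HIT by the shift `e₇`
(its type changes, `E⁺ = −9`), so for `b + e₇` the minimal set is `EZ` minus that pair (`classExp_shift7_ge_succ` puts the hit classes into the
rest).  `p¹⁷Cas₇ = (p⁷W′)(p¹⁰V) − (p⁷W)(p¹⁰V′) ≡ 0 (mod p²)`.  Valuations of rationals; nothing about irrationality.  Exact cross-check:
`code/p1/g6/cellEz_check.py` (8 primes, `n ≤ 16`: `v(W) = −6`, `v(V) = −9`, `v(Cas₇) = −14`).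
-/

noncomputable section

open Finset

namespace Summit.KontsevichZagierPeriods.Zeta5Search.CellE

open Summit.KontsevichZagierPeriods.Zeta5Search.DualSeries (InBox)
open Summit.KontsevichZagierPeriods.Zeta5Search.WedgeDictionary (pfData coeffW coeffV)
open Summit.KontsevichZagierPeriods.Zeta5Search.CasoratianValuation (InPolytope shift casoratian)
open Summit.KontsevichZagierPeriods.Zeta5Search.ClusterValuation
open Summit.KontsevichZagierPeriods.Zeta5Search.PadicSeries
open Summit.KontsevichZagierPeriods.Zeta5Search.BigPrime (shift_zero padicNorm_mul_le_one)
open Summit.KontsevichZagierPeriods.Zeta5Search.CellA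
open Summit.KontsevichZagierPeriods.Zeta5Search.LevelClass
open Summit.KontsevichZagierPeriods.Zeta5Search.CellD (he_of_six padicNorm_classW_le padicNorm_classV_le_of small_of_two_mul)
open Summit.KontsevichZagierPeriods.Zeta5Search.CellC (small_scale small_mul_small)

variable {p : ℕ} [hp : Fact p.Prime]

/-! ### §1 The digits of a level class of class exponent `−10` -/

/-- The six-point palindromic type `(1,0,−6,−6,0,1)`. -/
def eE : ℕ → ℤ
  | 0 => 1 | 1 => 0 | 2 => -6 | 3 => -6 | 4 => 0 | 5 => 1 | _ => 0

/-- `E = −10`. -/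
theorem typeExp_eE : typeExp 5 eE = -10 := by decide

omit hp in
/-- `(−p)^{−(−10+3)} = −p⁷`. -/
theorem negp_zpow_seven : (-(p : ℚ)) ^ (-((-10 : ℤ) + 3)) = -(p : ℚ) ^ 7 := by
  rw [show (-((-10 : ℤ) + 3)) = ((7 : ℕ) : ℤ) by norm_num, zpow_natCast]; ring

omit hp in
/-- `(−p)^{−(−10)} = p¹⁰`. -/
theorem negp_zpow_ten : (-(p : ℚ)) ^ (-(-10 : ℤ)) = (p : ℚ) ^ 10 := by
  rw [show (-(-10 : ℤ)) = ((10 : ℕ) : ℤ) by norm_num, zpow_natCast]; ring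

/-- `(−1)^{−10+1} = −1`. -/
theorem neg_one_zpow_m9 : (-1 : ℚ) ^ ((-10 : ℤ) + 1) = -1 := by
  rw [show ((-10 : ℤ) + 1) = -(9 : ℕ) by norm_num, zpow_neg, zpow_natCast]; norm_num

/-- **The digits of ONE centre-free level class of a type with `E = −10`**: `‖p⁷W_x + g·ŵ‖ ≤ p⁻¹`, `‖p¹⁰V_x − g·v̂‖ ≤ p⁻¹` for any `g ≡ ĝ_x`,
and the conjugate unit `‖ĝ_{N−(x+Lp)} + ĝ_x‖ ≤ p⁻¹`. -/
theorem digits_of_level10 (hp5 : 5 ≤ p) (b : ℕ → ℤ) (hb : InPolytope b) (hwin : (b 0 + 2 : ℤ) < (p : ℤ) ^ 2) {N : ℕ}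
    (hN : (b 0).toNat = N) {x L : ℕ} (hx : x < p) (hL : x + L * p ≤ N) (hL' : N < x + L * p + p)
    (hc : ¬ CentreIn b p x) {e : ℕ → ℤ} (hE : typeExp L e = -10) {i₀ : ℕ} (hi₀ : i₀ ≤ L) (hneg : e i₀ < 0)
    (he : ∀ k ≤ L, netExp b (x + k * p) = e k) {g : ℚ} (hg : padicNorm p (gHat b p x - g) ≤ (p : ℚ) ^ (-(1 : ℤ))) :
    padicNorm p ((p : ℚ) ^ 7 * classW b p x + g * typeW L e) ≤ (p : ℚ) ^ (-(1 : ℤ)) ∧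
    padicNorm p ((p : ℚ) ^ 10 * classV b p x - g * typeV L e) ≤ (p : ℚ) ^ (-(1 : ℤ)) ∧
    padicNorm p (gHat b p (N - (x + L * p)) + gHat b p x) ≤ (p : ℚ) ^ (-(1 : ℤ)) := by
  have hL1 : x + L * p ≤ (b 0).toNat := by rw [hN]; exact hL
  have hL2 : (b 0).toNat < x + L * p + p := by rw [hN]; exact hL'
  have hw := w_digit_level b hx hL1 hL2 hb hp5 hwin e he hc hi₀ hneg hg
  have hv := v_digit_level b hx hL1 hL2 hb hp5 hwin e he hc hi₀ hneg hg
  have hgc := gHat_conj_level b hx hL1 hL2 hb hp5 e he hc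
  rw [hE] at hw hv hgc
  rw [negp_zpow_seven, show -(p : ℚ) ^ 7 * classW b p x - g * typeW L e = -((p : ℚ) ^ 7 * classW b p x + g * typeW L e)
    by ring, padicNorm.neg] at hw
  rw [negp_zpow_ten] at hv
  rw [neg_one_zpow_m9, neg_one_mul, sub_neg_eq_add, hN] at hgc
  exact ⟨hw, hv, hgc⟩

/-! ### §2 The zero block over a conjugation-closed part `M ⊆ EZ` -/

section ZeroBlock

variable {n : ℕ} (hp24 : 24 * n < 4 * p) (hp25 : 4 * p < 25 * n) (hp5 : 5 ≤ p)
  (b : ℕ → ℤ) (hb : InPolytope b) (hwin : (b 0 + 2 : ℤ) < (p : ℤ) ^ 2) (hN : (b 0).toNat = 41 * n)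
  (hcen : ∀ x, x < p → 2 * x + 5 * p ≠ 41 * n → 2 * x + 6 * p ≠ 41 * n → ¬ CentreIn b p x)
  (M : Finset ℕ) (hM : M ⊆ EZ n p) (hconj : ∀ x ∈ M, 41 * n - (x + 5 * p) ∈ M)
  (hZ : ∀ x ∈ M, netExp b x = 1 ∧ netExp b (x + p) = 0 ∧ netExp b (x + 2 * p) = -6 ∧ netExp b (x + 3 * p) = -6 ∧
    netExp b (x + 4 * p) = 0 ∧ netExp b (x + 5 * p) = 1)
  (hrest : ∀ x, x < p → x ∉ M → padicNorm p (classW b p x) ≤ (p : ℚ) ^ (6 : ℤ) ∧ padicNorm p (classV b p x) ≤ (p : ℚ) ^ (9 : ℤ))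

include hp24 hp25 hp5 hb hwin hN hcen hM hconj hZ in
/-- **A minimal pair cancels in both digits**: `‖p⁷(W_x + W_x̄)‖ ≤ p⁻¹`, `‖p¹⁰(V_x + V_x̄)‖ ≤ p⁻¹`, `x̄ = 41n − (x+5p)`. -/
theorem packE {x : ℕ} (hx : x ∈ M) :
    padicNorm p ((p : ℚ) ^ 7 * (classW b p x + classW b p (41 * n - (x + 5 * p)))) ≤ (p : ℚ) ^ (-(1 : ℤ)) ∧
    padicNorm p ((p : ℚ) ^ 10 * (classV b p x + classV b p (41 * n - (x + 5 * p)))) ≤ (p : ℚ) ^ (-(1 : ℤ)) := by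
  have hx' := hconj x hx
  obtain ⟨e0, e1, e2, e3, e4, e5⟩ := hZ x hx
  obtain ⟨f0, f1, f2, f3, f4, f5⟩ := hZ _ hx'
  have hxe := mem_ez.1 (hM hx)
  have hxe' := mem_ez.1 (hM hx')
  obtain ⟨hxp, h11, h24, h30, hself⟩ := hxe
  set g := gHat b p x with hgdef
  have hg0 : padicNorm p (gHat b p x - g) ≤ (p : ℚ) ^ (-(1 : ℤ)) := by
    rw [hgdef, sub_self, padicNorm.zero]; exact zpow_p_nonneg _
  obtain ⟨w1, v1, hcj⟩ := digits_of_level10 hp5 b hb hwin hN hxp (L := 5) (by omega) (by omega)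
    (hcen x hxp hself (by omega)) typeExp_eE (i₀ := 2) (by norm_num) (by decide) (he_of_six e0 e1 e2 e3 e4 e5) hg0
  have hg1 : padicNorm p (gHat b p (41 * n - (x + 5 * p)) - (-g)) ≤ (p : ℚ) ^ (-(1 : ℤ)) := by
    rw [sub_neg_eq_add]; exact hcj
  obtain ⟨w2, v2, -⟩ := digits_of_level10 hp5 b hb hwin hN (x := 41 * n - (x + 5 * p)) (L := 5) (by omega)
    (by omega) (by omega) (hcen _ (by omega) hxe'.2.2.2.2 (by omega)) typeExp_eE (i₀ := 2) (by norm_num) (by decide)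
    (he_of_six f0 f1 f2 f3 f4 f5) hg1
  refine ⟨?_, ?_⟩
  · have e : (p : ℚ) ^ 7 * (classW b p x + classW b p (41 * n - (x + 5 * p))) =
        ((p : ℚ) ^ 7 * classW b p x + g * typeW 5 eE) +
          ((p : ℚ) ^ 7 * classW b p (41 * n - (x + 5 * p)) + (-g) * typeW 5 eE) := by ring
    rw [e]; exact small_add w1 w2
  · have e : (p : ℚ) ^ 10 * (classV b p x + classV b p (41 * n - (x + 5 * p))) =
        ((p : ℚ) ^ 10 * classV b p x - g * typeV 5 eE) +
          ((p : ℚ) ^ 10 * classV b p (41 * n - (x + 5 * p)) - (-g) * typeV 5 eE) := by ring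
    rw [e]; exact small_add v1 v2

include hM hconj in
omit hp in
/-- A sum over `M` equals the sum of the conjugates. -/
theorem sum_M_conj (f : ℕ → ℚ) : ∑ x ∈ M, f (41 * n - (x + 5 * p)) = ∑ x ∈ M, f x :=
  sum_nbij' (fun x => 41 * n - (x + 5 * p)) (fun x => 41 * n - (x + 5 * p)) (fun x hx => hconj x hx)
    (fun x hx => hconj x hx) (fun x hx => by have := mem_ez.1 (hM hx); omega)
    (fun x hx => by have := mem_ez.1 (hM hx); omega) (fun x hx => rfl)

include hp24 hp25 hp5 hb hwin hN hcen hM hconj hZ hrest in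
/-- **THE ZERO BLOCK**: `‖p⁷·W(b′)‖ ≤ p⁻¹` and `‖p¹⁰·V(b′)‖ ≤ p⁻¹`. -/
theorem zeroBlockE : padicNorm p ((p : ℚ) ^ 7 * coeffW b) ≤ (p : ℚ) ^ (-(1 : ℤ)) ∧
    padicNorm p ((p : ℚ) ^ 10 * coeffV b) ≤ (p : ℚ) ^ (-(1 : ℤ)) := by
  have PZ := fun x (hx : x ∈ M) => packE hp24 hp25 hp5 b hb hwin hN hcen M hM hconj hZ hx
  have hMr : M ⊆ range p := hM.trans (ez_subset n p)
  have split : ∀ f : ℕ → ℚ, ∑ x ∈ range p, f x = ∑ x ∈ M, f x + ∑ x ∈ range p \ M, f x := fun f => by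
    rw [← sum_union disjoint_sdiff, union_sdiff_of_subset hMr]
  refine ⟨?_, ?_⟩
  · rw [coeffW_eq_sum_classW b hp.out.pos, mul_sum, split]
    refine small_add (small_of_two_mul hp5 ?_) (padicNorm.sum_le' (fun x hx => ?_) (zpow_p_nonneg _))
    · have e2 : (2 : ℚ) * ∑ x ∈ M, (p : ℚ) ^ 7 * classW b p x =
          ∑ x ∈ M, (p : ℚ) ^ 7 * (classW b p x + classW b p (41 * n - (x + 5 * p))) := by
        rw [two_mul, sum_congr rfl fun x _ => mul_add _ _ _, sum_add_distrib,
          sum_M_conj M hM hconj (fun x => (p : ℚ) ^ 7 * classW b p x)]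
      rw [e2]
      exact padicNorm.sum_le' (fun x hx => (PZ x hx).1) (zpow_p_nonneg _)
    · rw [mem_sdiff, mem_range] at hx
      exact small_scale (k := 7) (by have := (hrest x hx.1 hx.2).1; norm_num at this ⊢; exact this)
  · rw [coeffV_eq_sum_classV b hp.out.pos, mul_sum, split]
    refine small_add (small_of_two_mul hp5 ?_) (padicNorm.sum_le' (fun x hx => ?_) (zpow_p_nonneg _))
    · have e2 : (2 : ℚ) * ∑ x ∈ M, (p : ℚ) ^ 10 * classV b p x =
          ∑ x ∈ M, (p : ℚ) ^ 10 * (classV b p x + classV b p (41 * n - (x + 5 * p))) := by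
        rw [two_mul, sum_congr rfl fun x _ => mul_add _ _ _, sum_add_distrib,
          sum_M_conj M hM hconj (fun x => (p : ℚ) ^ 10 * classV b p x)]
      rw [e2]
      exact padicNorm.sum_le' (fun x hx => (PZ x hx).2) (zpow_p_nonneg _)
    · rw [mem_sdiff, mem_range] at hx
      exact small_scale (k := 10) (by have := (hrest x hx.1 hx.2).2; norm_num at this ⊢; exact this)

end ZeroBlock

/-! ### §3 The rest data for `b(n)` and `b(n) + e₇` (with the hit pair), and the theorem -/

section Rest

variable {n : ℕ} (hn : 1 ≤ n) (hp24 : 24 * n < 4 * p) (hp25 : 4 * p < 25 * n) (hp5 : 5 ≤ p)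

include hp24 hp25 hp5 in
/-- Off `EZ`: `‖W_x(b)‖ ≤ p⁶`, `‖V_x(b)‖ ≤ p⁹` (class exponent `≥ −9`). -/
theorem restE {x : ℕ} (hx : x < p) (hm : x ∉ EZ n p) :
    padicNorm p (classW (bRec n) p x) ≤ (p : ℚ) ^ (6 : ℤ) ∧ padicNorm p (classV (bRec n) p x) ≤ (p : ℚ) ^ (9 : ℤ) := by
  have hb := inPolytope_bRec n
  have hwin : (bRec n 0 + 2 : ℤ) < (p : ℤ) ^ 2 := by rw [bRec_zero]; nlinarith
  have hodd : ¬ 2 ∣ p := fun h => by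
    have := (Nat.prime_dvd_prime_iff_eq Nat.prime_two hp.out).1 h; omega
  have hE := classExpE_ge_of_notMin hp24 hp25 hx hodd hm
  refine ⟨?_, ?_⟩
  · have := padicNorm_classW_le (m := -9) _ hb hp5 hwin (by norm_num) (fun _ => hE)
    norm_num at this; exact this
  · have := padicNorm_classV_le_of (v := -9) _ hb hp5 hwin hx (fun _ => hE.trans (classExp_le_classNu _ _ _))
    norm_num at this; exact this

omit hp in
/-- **The shift raises the class exponent by at least one on a class through a moved point.** -/
theorem classExp_shift7_ge_succ {x : ℕ} (hmem : 11 * n ∈ classSet (bRec n) p x ∨ 30 * n ∈ classSet (bRec n) p x) :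
    classExp (bRec n) p x + 1 ≤ classExp (shift (bRec n) 7) p x := by
  have hb := inPolytope_bRec n
  have h7 : (bRec n 7).toNat = 11 * n := bRec_succ_toNat n 6 (by norm_num)
  have h0 : (bRec n 0).toNat = 41 * n := bRec_zero_toNat n
  have h2 : 2 * bRec n 7 ≤ bRec n 0 := by simp [bRec]; omega
  have hshift : ∀ s, netExp (shift (bRec n) 7) s =
      netExp (bRec n) s + (if s = 11 * n ∨ s = 41 * n - 11 * n then 1 else 0) := fun s => by
    rw [netExp_shift_eq (bRec n) hb.1 (by norm_num) (by norm_num) h2 s, h7, h0]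
  have hcen : (if ¬ (2 : ℤ) ∣ shift (bRec n) 7 0 ∧ CentreIn (shift (bRec n) 7) p x then (1 : ℤ) else 0) =
      (if ¬ (2 : ℤ) ∣ bRec n 0 ∧ CentreIn (bRec n) p x then (1 : ℤ) else 0) := by
    rw [shift_zero _ (by norm_num)]
    simp only [centreIn_shift (bRec n) (by norm_num : 1 ≤ 7)]
  unfold classExp
  rw [classSet_shift (bRec n) (by norm_num : 1 ≤ 7), hcen, sum_congr rfl (fun s _ => hshift s), sum_add_distrib]
  have hone : (1 : ℤ) ≤ ∑ s ∈ classSet (bRec n) p x, (if s = 11 * n ∨ s = 41 * n - 11 * n then (1 : ℤ) else 0) := by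
    rcases hmem with h | h
    · refine le_trans (by rw [if_pos (Or.inl rfl)]) (single_le_sum (fun i _ => by positivity) h)
    · refine le_trans (by rw [if_pos (Or.inr (by omega))]) (single_le_sum (fun i _ => by positivity) h)
  linarith

include hn hp24 hp25 hp5 in
/-- Off `EZ⁺ = EZ ∖ (hit pair)`: `‖W_x(b+e₇)‖ ≤ p⁶`, `‖V_x(b+e₇)‖ ≤ p⁹`. -/
theorem restE_shift {x : ℕ} (hx : x < p) (hm : x ∉ (EZ n p).filter (fun y => y + p ≠ 11 * n ∧ y + 4 * p ≠ 30 * n)) :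
    padicNorm p (classW (shift (bRec n) 7) p x) ≤ (p : ℚ) ^ (6 : ℤ) ∧
      padicNorm p (classV (shift (bRec n) 7) p x) ≤ (p : ℚ) ^ (9 : ℤ) := by
  have hb := inPolytope_bRec n
  have hb' := inPolytope_shift_bRec n 7 hn (by norm_num) (by norm_num)
  have hwin : (bRec n 0 + 2 : ℤ) < (p : ℤ) ^ 2 := by rw [bRec_zero]; nlinarith
  have hwin' : (shift (bRec n) 7 0 + 2 : ℤ) < (p : ℤ) ^ 2 := by rw [shift_zero _ (by norm_num)]; exact hwin
  have hodd : ¬ 2 ∣ p := fun h => by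
    have := (Nat.prime_dvd_prime_iff_eq Nat.prime_two hp.out).1 h; omega
  have hE' : -9 ≤ classExp (shift (bRec n) 7) p x := by
    by_cases hz : x ∈ EZ n p
    · -- a hit class: `E = −10` and the shift adds one
      have hhit : x + p = 11 * n ∨ x + 4 * p = 30 * n := by
        rw [mem_filter] at hm; push Not at hm
        by_contra hc; push Not at hc; exact absurd (hm hz hc.1) (by simpa using hc.2)
      obtain ⟨⟨e0, e1, e2, e3, e4, e5⟩, hxp, h5, h6, hs5, hs6⟩ := netExp_ez hp24 hp25 hz
      have hE : -10 ≤ classExp (bRec n) p x := by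
        have := classExpE_ge_six hp24 hp25 hx (by omega); omega
      have hmem : 11 * n ∈ classSet (bRec n) p x ∨ 30 * n ∈ classSet (bRec n) p x := by
        rw [classSet_bRecE hp24 hp25 hx, if_neg (by omega)]
        rcases hhit with h | h
        · exact Or.inl (by rw [← h]; simp)
        · exact Or.inr (by rw [← h]; simp)
      have := classExp_shift7_ge_succ (n := n) (p := p) hmem
      omega
    · exact (classExpE_ge_of_notMin hp24 hp25 hx hodd hz).trans (classExp_shift_ge _ hb.1 (by norm_num) p x)
  refine ⟨?_, ?_⟩
  · have := padicNorm_classW_le (m := -9) _ hb' hp5 hwin' (by norm_num) (fun _ => hE')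
    norm_num at this; exact this
  · have := padicNorm_classV_le_of (v := -9) _ hb' hp5 hwin' hx (fun _ => hE'.trans (classExp_le_classNu _ _ _))
    norm_num at this; exact this

end Rest

/-- **RECORD CELL E IS A THEOREM.**  For `n ≥ 2` and every prime `p` with `24n < 4p < 25n`:
`v_p(W(b′)) ≥ −6` and `v_p(V(b′)) ≥ −9` for `b′ = b(n), b(n)+e₇`, hence `v_p(Cas₇(b(n))) ≥ −15` (THEOREM LB: `−17`). -/
theorem recordCellEz : ∀ n p : ℕ, 2 ≤ n → p.Prime → 24 * n < 4 * p → 4 * p < 25 * n → casoratian (bRec n) 7 ≠ 0 →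
    (-15 : ℤ) ≤ padicValRat p (casoratian (bRec n) 7) := by
  intro n p hn2 hprime hp24 hp25 hne
  haveI : Fact p.Prime := ⟨hprime⟩
  have hn : 1 ≤ n := by omega
  have hp5 : 5 ≤ p := by omega
  set b := bRec n with hbdef
  set b' := shift (bRec n) 7 with hb'def
  have hb : InPolytope b := inPolytope_bRec n
  have hb' : InPolytope b' := inPolytope_shift_bRec n 7 hn (by norm_num) (by norm_num)
  have hwin : (b 0 + 2 : ℤ) < (p : ℤ) ^ 2 := by rw [hbdef, bRec_zero]; nlinarith
  have hwin' : (b' 0 + 2 : ℤ) < (p : ℤ) ^ 2 := by rw [hb'def, shift_zero _ (by norm_num)]; exact hwin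
  have hN : (b 0).toNat = 41 * n := bRec_zero_toNat n
  have hN' : (b' 0).toNat = 41 * n := shift7_zero_toNat n
  have hcen : ∀ x, x < p → 2 * x + 5 * p ≠ 41 * n → 2 * x + 6 * p ≠ 41 * n → ¬ CentreIn b p x :=
    fun x hx h5 h6 => not_centreInE hp24 hp25 hx h5 h6
  have hcen' : ∀ x, x < p → 2 * x + 5 * p ≠ 41 * n → 2 * x + 6 * p ≠ 41 * n → ¬ CentreIn b' p x :=
    fun x hx h5 h6 h => not_centreInE hp24 hp25 hx h5 h6 ((centreIn_shift (bRec n) (by norm_num : 1 ≤ 7) p x).1 h)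
  -- the minimal sets: `EZ` for `b`, `EZ` minus the hit pair for `b + e₇`
  set Mp := (EZ n p).filter (fun y => y + p ≠ 11 * n ∧ y + 4 * p ≠ 30 * n) with hMp
  have hconj : ∀ x ∈ EZ n p, 41 * n - (x + 5 * p) ∈ EZ n p := fun x hx => (conj_mem_ez hp24 hx).1
  have hconj' : ∀ x ∈ Mp, 41 * n - (x + 5 * p) ∈ Mp := by
    intro x hx
    rw [hMp, mem_filter] at hx ⊢
    obtain ⟨hz, h1, h4⟩ := hx
    obtain ⟨hz', i1, i4⟩ := conj_mem_ez hp24 hz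
    exact ⟨hz', fun h => h4 (i4.2 h), fun h => h1 (i1.2 h)⟩
  have hZ := fun x (hx : x ∈ EZ n p) => (netExp_ez hp24 hp25 hx).1
  have hZ' : ∀ x ∈ Mp, netExp b' x = 1 ∧ netExp b' (x + p) = 0 ∧ netExp b' (x + 2 * p) = -6 ∧
      netExp b' (x + 3 * p) = -6 ∧ netExp b' (x + 4 * p) = 0 ∧ netExp b' (x + 5 * p) = 1 := by
    intro x hx
    rw [hMp, mem_filter] at hx
    exact netExp_ez_shift hp24 hp25 hx.1 hx.2.1 hx.2.2
  obtain ⟨sW, sV⟩ := zeroBlockE hp24 hp25 hp5 b hb hwin hN hcen (EZ n p) subset_rfl hconj hZ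
    (fun x hx hm => restE hp24 hp25 hp5 hx hm)
  obtain ⟨sW', sV'⟩ := zeroBlockE hp24 hp25 hp5 b' hb' hwin' hN' hcen' Mp (filter_subset _ _) hconj' hZ'
    (fun x hx hm => restE_shift hn hp24 hp25 hp5 hx hm)
  have e : (p : ℚ) ^ 17 * casoratian b 7 =
      ((p : ℚ) ^ 7 * coeffW b') * ((p : ℚ) ^ 10 * coeffV b) - ((p : ℚ) ^ 7 * coeffW b) * ((p : ℚ) ^ 10 * coeffV b') := by
    rw [casoratian, ← hb'def]; ring
  have h17 : padicNorm p ((p : ℚ) ^ 17 * casoratian b 7) ≤ (p : ℚ) ^ (-(2 : ℤ)) := by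
    rw [e]
    exact (padicNorm.sub (p := p)).trans (max_le (small_mul_small sW' sV) (small_mul_small sW sV'))
  apply val_ge_of_padicNorm_le hne
  have hp0 : (p : ℚ) ≠ 0 := Nat.cast_ne_zero.2 hprime.ne_zero
  have hp17n : padicNorm p ((p : ℚ) ^ 17) = ((p : ℚ) ^ 17)⁻¹ := padicNorm_p_pow 17
  have hpos : (0 : ℚ) < (p : ℚ) ^ 17 := pow_pos (by exact_mod_cast hprime.pos) 17
  rw [padicNorm.mul, hp17n, inv_mul_le_iff₀ hpos] at h17
  refine h17.trans (le_of_eq ?_)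
  rw [neg_neg, ← zpow_natCast, ← zpow_add₀ hp0]
  norm_num

/-- The digit-free content on its own: **`v_p(W(b(n))) ≥ −6` and `v_p(V(b(n))) ≥ −9`** on cell E. -/
theorem zeroCellE_WV (n p : ℕ) (hn2 : 2 ≤ n) (hprime : p.Prime) (hp24 : 24 * n < 4 * p) (hp25 : 4 * p < 25 * n) :
    (coeffW (bRec n) ≠ 0 → (-6 : ℤ) ≤ padicValRat p (coeffW (bRec n))) ∧
    (coeffV (bRec n) ≠ 0 → (-9 : ℤ) ≤ padicValRat p (coeffV (bRec n))) := by
  haveI : Fact p.Prime := ⟨hprime⟩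
  have hp5 : 5 ≤ p := by omega
  have hb : InPolytope (bRec n) := inPolytope_bRec n
  have hwin : (bRec n 0 + 2 : ℤ) < (p : ℤ) ^ 2 := by rw [bRec_zero]; nlinarith
  have hcen : ∀ x, x < p → 2 * x + 5 * p ≠ 41 * n → 2 * x + 6 * p ≠ 41 * n → ¬ CentreIn (bRec n) p x :=
    fun x hx h5 h6 => not_centreInE hp24 hp25 hx h5 h6
  obtain ⟨sW, sV⟩ := zeroBlockE hp24 hp25 hp5 (bRec n) hb hwin (bRec_zero_toNat n) hcen (EZ n p) subset_rfl
    (fun x hx => (conj_mem_ez hp24 hx).1) (fun x hx => (netExp_ez hp24 hp25 hx).1) (fun x hx hm => restE hp24 hp25 hp5 hx hm)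
  have hp0 : (p : ℚ) ≠ 0 := Nat.cast_ne_zero.2 hprime.ne_zero
  have key : ∀ (k : ℕ) (X : ℚ), X ≠ 0 → padicNorm p ((p : ℚ) ^ k * X) ≤ (p : ℚ) ^ (-(1 : ℤ)) →
      (1 : ℤ) - k ≤ padicValRat p X := by
    intro k X hX h
    apply val_ge_of_padicNorm_le hX
    have hpk : padicNorm p ((p : ℚ) ^ k) = ((p : ℚ) ^ k)⁻¹ := padicNorm_p_pow k
    have hpos : (0 : ℚ) < (p : ℚ) ^ k := pow_pos (by exact_mod_cast hprime.pos) k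
    rw [padicNorm.mul, hpk, inv_mul_le_iff₀ hpos] at h
    refine h.trans (le_of_eq ?_)
    rw [← zpow_natCast, ← zpow_add₀ hp0]; congr 1; ring
  exact ⟨fun hW => by have := key 7 _ hW sW; norm_num at this; exact this,
    fun hV => by have := key 10 _ hV sV; norm_num at this; exact this⟩

end Summit.KontsevichZagierPeriods.Zeta5Search.CellE

end
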